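import Mathlib
import Summits.MatrixMultiplication.MatrixMultiplication.Theorems.SubgroupIdentityDesigns.Negative.TorusBudget
import Summits.MatrixMultiplication.MatrixMultiplication.Theorems.SubgroupIdentityDesigns.Negative.BorelCounting

/-!
# The middle torus budget (all `p`): a Borel-type `p`-member in the MIDDLE position

Route `LevelGradedCohnUmans`, crux `SubgroupIdentityDesigns`, the `(m,k) = (2,1)` cell.

The torus budget (`TorusBudget.torus_budget`) needs `U⁺` inside the FIRST member.  Here `U⁺` sits
in the MIDDLE member: for a subgroup-TPP triple `(H₁, H₂, H₃)` of `GL₂(𝔽_p)` with `U⁺ ≤ H₂`, an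
upper-triangular subgroup `E₁ ≤ H₁`, a diagonal subgroup `D₂ ≤ H₂`, an upper-triangular subgroup
`S₃ ≤ H₃` and a level-`1` identity design, `|E₁|·|D₂|·|S₃| ≤ p - 1` (`torus_budget_middle`).

Mechanism.  A point `e d s` (`e ∈ E₁`, `d ∈ D₂`, `s ∈ S₃`) is upper triangular, and since `e ∈ B⁺`
normalises `U⁺ ≤ H₂` its whole cell `U⁺·eds = e·(e⁻¹U⁺e)d·s` lies in `H₁H₂H₃`
(`cell_of_middle_triple`); the diagonals of these points form the subgroup
`G = σ(E₁)σ(D₂)σ(S₃)` of the torus, of order `|E₁||D₂||S₃|` by a TPP rigidity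
(`middle_triple_injective`: a unitriangular discrepancy is absorbed into `H₂` through `E₁ ≤ B⁺`);
if `|G| > p - 1` the pigeonhole of `DiagonalRectangles` produces the rectangle `{1,a} × {1,μ}` of
full cells and the certificate of `TripleCells` pairs to `f(1) = 1`
(`no_idTest_of_diag_subgroup_cells`, the cell version of the diagonal-subgroup law).

Consequences (`volume_law_middle`, `no_levelOne_witness_borel_middle`): if `H₂` is conjugate to
a subgroup `K` with `U⁺ ≤ K ≤ B⁺` (a `p`-member with a unique Sylow `p`-subgroup) and `H₁, H₃` are
ARBITRARY, then `|H₁||H₂||H₃| ≤ p(p+1)²(p-1) ≤ 1 + p³ + (p-2)(p+1)³` for `p ≥ 5`: NO level-one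
witness.  With `EndPlacements` (ends), `SLMemberLaw` (`SL₂`-members) and the two-`p`-member laws,
the `(2,1)` cell for `p ≥ 5` is reduced to triples all of whose members have order prime to `p`
(modulo the dichotomy "a `p`-member contains `SL₂` or is Borel-type", standard Sylow theory in
`GL₂(𝔽_p)`, to be formalised) and to `p = 3`.
VALUE = THEOREM (all `p`), NOT summit progress; the crux item stmt-MatrixMultiplication-14079 is
untouched and remains open.
-/

set_option linter.dupNamespace false

noncomputable section

open scoped BigOperators Classical

open Summit.MatrixMultiplication.MatrixMultiplication.Theorems.LieRankDesigns.Negative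
  (GLm Mat fourierFn budget)
open Summit.MatrixMultiplication.MatrixMultiplication.Theorems.LevelOneGL2Designs.Negative
  (levelSubmodule fourierFn_mem_levelSubmodule)

namespace Summit.MatrixMultiplication.MatrixMultiplication.Theorems.SubgroupIdentityDesigns.Negative

section MiddleTorus

open Literature.Barriers.MatrixMultiplication (SubgroupTPP)

variable {p : ℕ} [hp : Fact p.Prime]

/-- Entries of the inverse of an upper-triangular element. -/
theorem inv_entries_of_upper (a : GLm p 2) (ha : (a : Mat p 2) 1 0 = 0) :
    ((a⁻¹ : GLm p 2) : Mat p 2) 1 0 = 0 ∧ ((a⁻¹ : GLm p 2) : Mat p 2) 0 0 * (a : Mat p 2) 0 0 = 1 ∧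
      ((a⁻¹ : GLm p 2) : Mat p 2) 1 1 * (a : Mat p 2) 1 1 = 1 := by
  have hd := diag_ne_zero_of_upper ha
  obtain ⟨e00, e10, e11⟩ := entries_mul_upper a⁻¹ a ha
  rw [inv_mul_cancel] at e00 e10 e11
  have one00 : ((1 : GLm p 2) : Mat p 2) 0 0 = 1 := by simp
  have one10 : ((1 : GLm p 2) : Mat p 2) 1 0 = 0 := by simp
  have one11 : ((1 : GLm p 2) : Mat p 2) 1 1 = 1 := by simp
  have h10 : ((a⁻¹ : GLm p 2) : Mat p 2) 1 0 = 0 := by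
    rw [one10] at e10
    exact (mul_eq_zero.mp e10.symm).resolve_right hd.1
  refine ⟨h10, by rw [one00] at e00; exact e00.symm, ?_⟩
  rw [one11, h10, zero_mul, zero_add] at e11
  exact e11.symm

/-- Conjugating a unitriangular element by an upper-triangular one gives a unitriangular
element (`B⁺` normalises `U⁺`). -/
theorem unitri_conj_upper {a v : GLm p 2} (ha : (a : Mat p 2) 1 0 = 0)
    (hv10 : (v : Mat p 2) 1 0 = 0) (hv00 : (v : Mat p 2) 0 0 = 1) (hv11 : (v : Mat p 2) 1 1 = 1) :
    ((a⁻¹ * v * a : GLm p 2) : Mat p 2) 1 0 = 0 ∧ ((a⁻¹ * v * a : GLm p 2) : Mat p 2) 0 0 = 1 ∧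
      ((a⁻¹ * v * a : GLm p 2) : Mat p 2) 1 1 = 1 := by
  obtain ⟨i10, i00, i11⟩ := inv_entries_of_upper a ha
  obtain ⟨f00, f10, f11⟩ := entries_mul_upper a⁻¹ v hv10
  obtain ⟨g00, g10, g11⟩ := entries_mul_upper (a⁻¹ * v) a ha
  refine ⟨?_, ?_, ?_⟩
  · rw [g10, f10, i10, zero_mul, zero_mul]
  · rw [g00, f00, hv00, mul_one, i00]
  · rw [g11, f10, i10, zero_mul, zero_mul, zero_add, f11, i10, zero_mul, zero_add, hv11, mul_one,
      i11]

/-- **Cells through the middle member.**  If `U⁺ ≤ H₂` and a triple product `a b c` with `a`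
upper triangular is upper triangular with diagonal `(α, β)`, the whole cell `B(α, β)` consists of
triple products: `u·abc = a·(a⁻¹ua)b·c` with `a⁻¹ua ∈ U⁺ ≤ H₂`. -/
theorem cell_of_middle_triple {H₁ H₂ H₃ : Subgroup (GLm p 2)}
    (hU₂ : ∀ u : GLm p 2, (u : Mat p 2) 1 0 = 0 → (u : Mat p 2) 0 0 = 1 → (u : Mat p 2) 1 1 = 1 →
      u ∈ H₂)
    {α β : ZMod p} (hβ : β ≠ 0)
    (h : ∃ y : ZMod p, ∃ a ∈ H₁, ∃ b ∈ H₂, ∃ c ∈ H₃, (a : Mat p 2) 1 0 = 0 ∧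
      ((a * b * c : GLm p 2) : Mat p 2) = !![α, y; 0, β])
    (x : ZMod p) :
    ∃ a ∈ H₁, ∃ b ∈ H₂, ∃ c ∈ H₃, ((a * b * c : GLm p 2) : Mat p 2) = !![α, x; 0, β] := by
  obtain ⟨y, a, ha, b, hb, c, hc, ha10, habc⟩ := h
  obtain ⟨u, hu⟩ : ∃ u : GLm p 2, (u : Mat p 2) = !![1, (x - y) / β; 0, 1] :=
    ⟨Matrix.GeneralLinearGroup.mkOfDetNeZero _ (by rw [Matrix.det_fin_two_of]; simp), rfl⟩
  obtain ⟨w10, w00, w11⟩ :=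
    unitri_conj_upper (v := u) ha10 (by simp [hu]) (by simp [hu]) (by simp [hu])
  refine ⟨a, ha, a⁻¹ * u * a * b, H₂.mul_mem (hU₂ _ w10 w00 w11) hb, c, hc, ?_⟩
  have hg : a * (a⁻¹ * u * a * b) * c = u * (a * b * c) := by group
  rw [hg, Units.val_mul, hu, habc]
  ext i j
  fin_cases i <;> fin_cases j <;> simp [Matrix.mul_apply, Fin.sum_univ_two]
  field_simp
  ring

/-- **Diagonal-subgroup law, cell version (pigeonhole; no `U⁺`-hypothesis).**  If the full upper
cells over a subgroup `G` of `𝔽_p^× × 𝔽_p^×` with `|G| > p − 1` consist of triple products of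
`(H₁, H₂, H₃)`, there is no level-1 identity design. -/
theorem no_idTest_of_diag_subgroup_cells {H₁ H₂ H₃ : Subgroup (GLm p 2)}
    (G : Subgroup ((ZMod p)ˣ × (ZMod p)ˣ))
    (hG : ∀ g ∈ G, ∀ x : ZMod p, ∃ a ∈ H₁, ∃ b ∈ H₂, ∃ c ∈ H₃,
      ((a * b * c : GLm p 2) : Mat p 2) = !![((g.1 : (ZMod p)ˣ) : ZMod p), x; 0, (g.2 : ZMod p)])
    (hcard : p - 1 < Nat.card G) :
    ¬ ∃ f ∈ levelSubmodule p 2 1, f 1 = 1 ∧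
        ∀ a' ∈ H₁, ∀ b ∈ H₂, ∀ c ∈ H₃, a' * b * c ≠ 1 → f (a' * b * c) = 0 := by
  have hlt : Fintype.card (ZMod p)ˣ < Fintype.card G := by
    rw [ZMod.card_units p, ← Nat.card_eq_fintype_card]; exact hcard
  obtain ⟨x, y, hxy, hf⟩ :=
    Fintype.exists_ne_map_eq_of_card_lt (fun g : G => ((g : (ZMod p)ˣ × (ZMod p)ˣ)).2) hlt
  obtain ⟨x', y', hxy', hf'⟩ :=
    Fintype.exists_ne_map_eq_of_card_lt (fun g : G => ((g : (ZMod p)ˣ × (ZMod p)ˣ)).1) hlt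
  set h : (ZMod p)ˣ × (ZMod p)ˣ := (x : (ZMod p)ˣ × (ZMod p)ˣ) * (y : (ZMod p)ˣ × (ZMod p)ˣ)⁻¹
    with hh
  set h' : (ZMod p)ˣ × (ZMod p)ˣ := (x' : (ZMod p)ˣ × (ZMod p)ˣ) * (y' : (ZMod p)ˣ × (ZMod p)ˣ)⁻¹
    with hh'
  have hhG : h ∈ G := G.mul_mem x.2 (G.inv_mem y.2)
  have hh'G : h' ∈ G := G.mul_mem x'.2 (G.inv_mem y'.2)
  have hh2 : h.2 = 1 := by
    simp only [hh, Prod.snd_mul, Prod.snd_inv, mul_inv_eq_one]; exact hf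
  have hh'1 : h'.1 = 1 := by
    simp only [hh', Prod.fst_mul, Prod.fst_inv, mul_inv_eq_one]; exact hf'
  have hh1 : h.1 ≠ 1 := by
    intro h1
    simp only [hh, Prod.fst_mul, Prod.fst_inv, mul_inv_eq_one] at h1
    exact hxy (Subtype.ext (Prod.ext h1 hf))
  have hh'2 : h'.2 ≠ 1 := by
    intro h2
    simp only [hh', Prod.snd_mul, Prod.snd_inv, mul_inv_eq_one] at h2
    exact hxy' (Subtype.ext (Prod.ext hf' h2))
  have ha0 : ((h.1 : (ZMod p)ˣ) : ZMod p) ≠ 0 := h.1.ne_zero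
  have ha1 : ((h.1 : (ZMod p)ˣ) : ZMod p) ≠ 1 := fun e => hh1 (Units.ext (by simpa using e))
  have hμ0 : ((h'.2 : (ZMod p)ˣ) : ZMod p) ≠ 0 := h'.2.ne_zero
  have hμ1 : ((h'.2 : (ZMod p)ˣ) : ZMod p) ≠ 1 := fun e => hh'2 (Units.ext (by simpa using e))
  have c11 : ∀ z : ZMod p, ∃ a ∈ H₁, ∃ b ∈ H₂, ∃ c ∈ H₃,
      ((a * b * c : GLm p 2) : Mat p 2) = !![1, z; 0, 1] := fun z => by
    simpa using hG 1 G.one_mem z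
  have c1μ : ∀ z : ZMod p, ∃ a ∈ H₁, ∃ b ∈ H₂, ∃ c ∈ H₃,
      ((a * b * c : GLm p 2) : Mat p 2) = !![1, z; 0, ((h'.2 : (ZMod p)ˣ) : ZMod p)] := fun z => by
    have e := hG h' hh'G z
    rwa [hh'1, Units.val_one] at e
  have ca1 : ∀ z : ZMod p, ∃ a ∈ H₁, ∃ b ∈ H₂, ∃ c ∈ H₃,
      ((a * b * c : GLm p 2) : Mat p 2) = !![((h.1 : (ZMod p)ˣ) : ZMod p), z; 0, 1] := fun z => by
    have e := hG h hhG z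
    rwa [hh2, Units.val_one] at e
  have caμ : ∀ z : ZMod p, ∃ a ∈ H₁, ∃ b ∈ H₂, ∃ c ∈ H₃,
      ((a * b * c : GLm p 2) : Mat p 2) =
        !![((h.1 : (ZMod p)ˣ) : ZMod p), z; 0, ((h'.2 : (ZMod p)ˣ) : ZMod p)] := fun z => by
    have e := hG (h * h') (G.mul_mem hhG hh'G) z
    rwa [Prod.fst_mul, Prod.snd_mul, hh'1, hh2, mul_one, one_mul] at e
  refine no_idTest_of_cells_in_triple ha0 ha1 hμ0 hμ1 fun α β hα hβ z => ?_
  rcases hα with hα | hα <;> rcases hβ with hβ | hβ <;> rw [hα, hβ]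
  exacts [c11 z, c1μ z, ca1 z, caμ z]

/-- **Middle rigidity under the subgroup TPP.**  With `U⁺ ≤ H₂`: if `e, e' ∈ H₁` are upper
triangular, `d, d' ∈ H₂` diagonal, `s, s' ∈ H₃` upper triangular, and `e d s`, `e' d' s'` have the
same diagonal, then `e = e'`, `d = d'`, `s = s'`. -/
theorem middle_triple_injective {H₁ H₂ H₃ : Subgroup (GLm p 2)} (htpp : SubgroupTPP H₁ H₂ H₃)
    (hU₂ : ∀ u : GLm p 2, (u : Mat p 2) 1 0 = 0 → (u : Mat p 2) 0 0 = 1 → (u : Mat p 2) 1 1 = 1 →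
      u ∈ H₂)
    {e e' d d' s s' : GLm p 2} (he : e ∈ H₁) (he' : e' ∈ H₁) (hd : d ∈ H₂) (hd' : d' ∈ H₂)
    (hs : s ∈ H₃) (hs' : s' ∈ H₃) (ge : (e : Mat p 2) 1 0 = 0) (ge' : (e' : Mat p 2) 1 0 = 0)
    (gd : (d : Mat p 2) 0 1 = 0 ∧ (d : Mat p 2) 1 0 = 0)
    (gd' : (d' : Mat p 2) 0 1 = 0 ∧ (d' : Mat p 2) 1 0 = 0)
    (gs : (s : Mat p 2) 1 0 = 0) (gs' : (s' : Mat p 2) 1 0 = 0)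
    (h00 : (e : Mat p 2) 0 0 * (d : Mat p 2) 0 0 * (s : Mat p 2) 0 0 =
      (e' : Mat p 2) 0 0 * (d' : Mat p 2) 0 0 * (s' : Mat p 2) 0 0)
    (h11 : (e : Mat p 2) 1 1 * (d : Mat p 2) 1 1 * (s : Mat p 2) 1 1 =
      (e' : Mat p 2) 1 1 * (d' : Mat p 2) 1 1 * (s' : Mat p 2) 1 1) :
    e = e' ∧ d = d' ∧ s = s' := by
  obtain ⟨hed0, hed1⟩ := diag_ne_zero_of_upper ge'
  obtain ⟨hdd0, hdd1⟩ := diag_ne_zero_of_upper gd'.2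
  obtain ⟨hsd0, hsd1⟩ := diag_ne_zero_of_upper gs'
  -- the three quotients
  obtain ⟨ie10, ie00, ie11⟩ := inv_entries_of_upper e' ge'
  obtain ⟨id10, id00, id11⟩ := inv_entries_of_upper d' gd'.2
  obtain ⟨is10, is00, is11⟩ := inv_entries_of_upper s' gs'
  obtain ⟨x00, x10, x11⟩ := entries_mul_upper (e'⁻¹ : GLm p 2) e ge
  obtain ⟨y00, y10, y11⟩ := entries_mul_upper d (d'⁻¹ : GLm p 2) id10
  obtain ⟨z00, z10, z11⟩ := entries_mul_upper s (s'⁻¹ : GLm p 2) is10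
  rw [ie10, zero_mul] at x10
  rw [ie10, zero_mul, zero_add] at x11
  rw [gd.2, zero_mul] at y10
  rw [gd.2, zero_mul, zero_add] at y11
  rw [gs, zero_mul] at z10
  rw [gs, zero_mul, zero_add] at z11
  -- `Q = x y z` is unitriangular
  obtain ⟨q00, q10, q11⟩ := entries_mul_upper ((e'⁻¹ : GLm p 2) * e) (d * (d'⁻¹ : GLm p 2)) y10
  rw [x10, zero_mul] at q10
  rw [x10, zero_mul, zero_add] at q11
  obtain ⟨Q00, Q10, Q11⟩ :=
    entries_mul_upper ((e'⁻¹ : GLm p 2) * e * (d * (d'⁻¹ : GLm p 2))) (s * (s'⁻¹ : GLm p 2)) z10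
  rw [q10, zero_mul] at Q10
  rw [q10, zero_mul, zero_add, q11, z11, x11, y11] at Q11
  rw [q00, x00, y00, z00] at Q00
  have i1 : ((e'⁻¹ : GLm p 2) : Mat p 2) 0 0 = ((e' : Mat p 2) 0 0)⁻¹ :=
    eq_inv_of_mul_eq_one_left ie00
  have i2 : ((d'⁻¹ : GLm p 2) : Mat p 2) 0 0 = ((d' : Mat p 2) 0 0)⁻¹ :=
    eq_inv_of_mul_eq_one_left id00
  have i3 : ((s'⁻¹ : GLm p 2) : Mat p 2) 0 0 = ((s' : Mat p 2) 0 0)⁻¹ :=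
    eq_inv_of_mul_eq_one_left is00
  have j1 : ((e'⁻¹ : GLm p 2) : Mat p 2) 1 1 = ((e' : Mat p 2) 1 1)⁻¹ :=
    eq_inv_of_mul_eq_one_left ie11
  have j2 : ((d'⁻¹ : GLm p 2) : Mat p 2) 1 1 = ((d' : Mat p 2) 1 1)⁻¹ :=
    eq_inv_of_mul_eq_one_left id11
  have j3 : ((s'⁻¹ : GLm p 2) : Mat p 2) 1 1 = ((s' : Mat p 2) 1 1)⁻¹ :=
    eq_inv_of_mul_eq_one_left is11
  set Q : GLm p 2 := (e'⁻¹ : GLm p 2) * e * (d * (d'⁻¹ : GLm p 2)) * (s * (s'⁻¹ : GLm p 2)) with hQ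
  have hQ00 : (Q : Mat p 2) 0 0 = 1 := by
    rw [Q00, i1, i2, i3]
    field_simp
    linear_combination h00
  have hQ11 : (Q : Mat p 2) 1 1 = 1 := by
    rw [Q11, j1, j2, j3]
    field_simp
    linear_combination h11
  -- absorb `Q⁻¹` into `H₂` through `x = e'⁻¹ e ∈ B⁺`
  obtain ⟨iQ10, iQ00, iQ11⟩ := inv_entries_of_upper Q Q10
  rw [hQ00, mul_one] at iQ00
  rw [hQ11, mul_one] at iQ11
  obtain ⟨w10, w00, w11⟩ := unitri_conj_upper (a := (e'⁻¹ : GLm p 2) * e) x10 iQ10 iQ00 iQ11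
  set w : GLm p 2 := ((e'⁻¹ : GLm p 2) * e)⁻¹ * Q⁻¹ * ((e'⁻¹ : GLm p 2) * e) with hw
  have hx : (e'⁻¹ : GLm p 2) * e ∈ H₁ := H₁.mul_mem (H₁.inv_mem he') he
  have hz : s * (s'⁻¹ : GLm p 2) ∈ H₃ := H₃.mul_mem hs (H₃.inv_mem hs')
  have hy : w * (d * (d'⁻¹ : GLm p 2)) ∈ H₂ :=
    H₂.mul_mem (hU₂ _ w10 w00 w11) (H₂.mul_mem hd (H₂.inv_mem hd'))
  have hrel : (e'⁻¹ : GLm p 2) * e * (w * (d * (d'⁻¹ : GLm p 2))) * (s * (s'⁻¹ : GLm p 2)) = 1 := by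
    rw [hw, hQ]; group
  obtain ⟨f₁, f₂, f₃⟩ := htpp _ hx _ hy _ hz hrel
  have hee : e = e' := (inv_mul_eq_one.mp f₁).symm
  have hss : s = s' := mul_inv_eq_one.mp f₃
  refine ⟨hee, ?_, hss⟩
  -- `w · (d d'⁻¹) = 1` with `w` unitriangular forces `d = d'`
  obtain ⟨P00, -, P11⟩ := entries_mul_upper w (d * (d'⁻¹ : GLm p 2)) y10
  rw [f₂] at P00 P11
  have one00 : ((1 : GLm p 2) : Mat p 2) 0 0 = 1 := by simp
  have one11 : ((1 : GLm p 2) : Mat p 2) 1 1 = 1 := by simp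
  rw [one00, w00, one_mul, y00, i2] at P00
  rw [one11, w10, zero_mul, zero_add, w11, one_mul, y11, j2] at P11
  have hd00 : (d : Mat p 2) 0 0 = (d' : Mat p 2) 0 0 := (mul_inv_eq_one₀ hdd0).mp P00.symm
  have hd11 : (d : Mat p 2) 1 1 = (d' : Mat p 2) 1 1 := (mul_inv_eq_one₀ hdd1).mp P11.symm
  apply Units.ext
  ext i j
  fin_cases i <;> fin_cases j
  · exact hd00
  · exact gd.1.trans gd'.1.symm
  · exact gd.2.trans gd'.2.symm
  · exact hd11

/-- **MIDDLE TORUS BUDGET.**  Subgroup TPP with `U⁺ ≤ H₂`, an upper-triangular subgroup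
`E₁ ≤ H₁`, a diagonal subgroup `D₂ ≤ H₂`, an upper-triangular subgroup `S₃ ≤ H₃`, and a level-1
identity test force `|E₁|·|D₂|·|S₃| ≤ p - 1`. -/
theorem torus_budget_middle {H₁ H₂ H₃ : Subgroup (GLm p 2)} (htpp : SubgroupTPP H₁ H₂ H₃)
    (hU₂ : ∀ u : GLm p 2, (u : Mat p 2) 1 0 = 0 → (u : Mat p 2) 0 0 = 1 → (u : Mat p 2) 1 1 = 1 →
      u ∈ H₂)
    {E₁ D₂ S₃ : Subgroup (GLm p 2)} (hE₁ : E₁ ≤ H₁) (hD₂ : D₂ ≤ H₂) (hS₃ : S₃ ≤ H₃)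
    (he₁ : ∀ e ∈ E₁, (e : Mat p 2) 1 0 = 0)
    (hd₂ : ∀ d ∈ D₂, (d : Mat p 2) 0 1 = 0 ∧ (d : Mat p 2) 1 0 = 0)
    (hs₃ : ∀ s ∈ S₃, (s : Mat p 2) 1 0 = 0)
    (hdesign : ∃ f ∈ levelSubmodule p 2 1, f 1 = 1 ∧
      ∀ a ∈ H₁, ∀ b ∈ H₂, ∀ c ∈ H₃, a * b * c ≠ 1 → f (a * b * c) = 0) :
    Nat.card E₁ * Nat.card D₂ * Nat.card S₃ ≤ p - 1 := by
  by_contra hlt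
  rw [not_le] at hlt
  obtain ⟨φ₁, hφ₁⟩ := exists_diagHom E₁ he₁
  obtain ⟨φ₂, hφ₂⟩ := exists_diagHom D₂ fun d hd => (hd₂ d hd).2
  obtain ⟨φ₃, hφ₃⟩ := exists_diagHom S₃ hs₃
  set G : Subgroup ((ZMod p)ˣ × (ZMod p)ˣ) := φ₁.range ⊔ φ₂.range ⊔ φ₃.range with hG
  -- entries of a triple product `e d s`
  have hP : ∀ (e : E₁) (d : D₂) (s : S₃),
      (((e : GLm p 2) * (d : GLm p 2) * (s : GLm p 2) : GLm p 2) : Mat p 2) 1 0 = 0 ∧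
        (((e : GLm p 2) * (d : GLm p 2) * (s : GLm p 2) : GLm p 2) : Mat p 2) 0 0 =
          ((e : GLm p 2) : Mat p 2) 0 0 * ((d : GLm p 2) : Mat p 2) 0 0 *
            ((s : GLm p 2) : Mat p 2) 0 0 ∧
        (((e : GLm p 2) * (d : GLm p 2) * (s : GLm p 2) : GLm p 2) : Mat p 2) 1 1 =
          ((e : GLm p 2) : Mat p 2) 1 1 * ((d : GLm p 2) : Mat p 2) 1 1 *
            ((s : GLm p 2) : Mat p 2) 1 1 := by
    intro e d s
    have g₁ := he₁ _ e.2
    have g₂ := hd₂ _ d.2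
    obtain ⟨a00, a10, a11⟩ := entries_mul_upper (e : GLm p 2) (d : GLm p 2) g₂.2
    rw [g₁, zero_mul] at a10
    rw [g₁, zero_mul, zero_add] at a11
    obtain ⟨b00, b10, b11⟩ :=
      entries_mul_upper ((e : GLm p 2) * (d : GLm p 2)) (s : GLm p 2) (hs₃ _ s.2)
    refine ⟨by rw [b10, a10, zero_mul], by rw [b00, a00], ?_⟩
    rw [b11, a10, zero_mul, zero_add, a11]
  -- every element of `G` carries a full upper cell of triple products
  have hGcell : ∀ g ∈ G, ∀ x : ZMod p, ∃ a ∈ H₁, ∃ b ∈ H₂, ∃ c ∈ H₃,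
      ((a * b * c : GLm p 2) : Mat p 2) =
        !![((g.1 : (ZMod p)ˣ) : ZMod p), x; 0, (g.2 : ZMod p)] := by
    intro g hg x
    obtain ⟨x12, hx12, x3, hx3, rfl⟩ := Subgroup.mem_sup.mp hg
    obtain ⟨x1, hx1, x2, hx2, rfl⟩ := Subgroup.mem_sup.mp hx12
    obtain ⟨e, rfl⟩ := MonoidHom.mem_range.mp hx1
    obtain ⟨d, rfl⟩ := MonoidHom.mem_range.mp hx2
    obtain ⟨s, rfl⟩ := MonoidHom.mem_range.mp hx3
    obtain ⟨P10, P00, P11⟩ := hP e d s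
    refine cell_of_middle_triple hU₂ (Units.ne_zero _)
      ⟨(((e : GLm p 2) * (d : GLm p 2) * (s : GLm p 2) : GLm p 2) : Mat p 2) 0 1, e, hE₁ e.2, d,
        hD₂ d.2, s, hS₃ s.2, he₁ _ e.2, ?_⟩ x
    ext i j
    fin_cases i <;> fin_cases j <;>
      simp [P10, P00, P11, (hφ₁ e).1, (hφ₁ e).2, (hφ₂ d).1, (hφ₂ d).2, (hφ₃ s).1, (hφ₃ s).2]
  -- `|G| ≥ |E₁| |D₂| |S₃|` by the middle rigidity
  have hmem : ∀ (e : E₁) (d : D₂) (s : S₃), φ₁ e * φ₂ d * φ₃ s ∈ G := fun e d s =>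
    G.mul_mem (G.mul_mem (Subgroup.mem_sup_left (Subgroup.mem_sup_left ⟨e, rfl⟩))
      (Subgroup.mem_sup_left (Subgroup.mem_sup_right ⟨d, rfl⟩))) (Subgroup.mem_sup_right ⟨s, rfl⟩)
  let Ψ : E₁ × D₂ × S₃ → G := fun q => ⟨φ₁ q.1 * φ₂ q.2.1 * φ₃ q.2.2, hmem q.1 q.2.1 q.2.2⟩
  have hΨ : Function.Injective Ψ := by
    rintro ⟨e, d, s⟩ ⟨e', d', s'⟩ eq
    have eq' : φ₁ e * φ₂ d * φ₃ s = φ₁ e' * φ₂ d' * φ₃ s' := congrArg Subtype.val eq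
    have e1 := congrArg (fun g : (ZMod p)ˣ × (ZMod p)ˣ => ((g.1 : (ZMod p)ˣ) : ZMod p)) eq'
    have e2 := congrArg (fun g : (ZMod p)ˣ × (ZMod p)ˣ => ((g.2 : (ZMod p)ˣ) : ZMod p)) eq'
    simp only [Prod.fst_mul, Prod.snd_mul, Units.val_mul, (hφ₁ _).1, (hφ₁ _).2, (hφ₂ _).1,
      (hφ₂ _).2, (hφ₃ _).1, (hφ₃ _).2] at e1 e2
    obtain ⟨f₁, f₂, f₃⟩ := middle_triple_injective htpp hU₂ (hE₁ e.2) (hE₁ e'.2) (hD₂ d.2)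
      (hD₂ d'.2) (hS₃ s.2) (hS₃ s'.2) (he₁ _ e.2) (he₁ _ e'.2) (hd₂ _ d.2) (hd₂ _ d'.2)
      (hs₃ _ s.2) (hs₃ _ s'.2) e1 e2
    simp only [Prod.mk.injEq]
    exact ⟨Subtype.ext f₁, Subtype.ext f₂, Subtype.ext f₃⟩
  have hcard : p - 1 < Nat.card G :=
    calc p - 1 < Nat.card E₁ * Nat.card D₂ * Nat.card S₃ := hlt
      _ = Nat.card (E₁ × D₂ × S₃) := by rw [Nat.card_prod, Nat.card_prod, mul_assoc]
      _ ≤ Nat.card G := Nat.card_le_card_of_injective Ψ hΨ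
  exact no_idTest_of_diag_subgroup_cells G hGcell hcard hdesign

/-- **Middle volume law** (all `p`): TPP + `U⁺ ≤ H₂ ≤ B⁺` + a level-`1` identity design ⇒
`|H₁|·|H₂|·|H₃| ≤ p(p+1)²(p-1)` for ARBITRARY `H₁, H₃`. -/
theorem volume_law_middle {H₁ H₂ H₃ : Subgroup (GLm p 2)} (htpp : SubgroupTPP H₁ H₂ H₃)
    (hB₂ : ∀ k ∈ H₂, (k : Mat p 2) 1 0 = 0)
    (hU₂ : ∀ u : GLm p 2, (u : Mat p 2) 1 0 = 0 → (u : Mat p 2) 0 0 = 1 → (u : Mat p 2) 1 1 = 1 →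
      u ∈ H₂)
    (hdesign : ∃ f ∈ levelSubmodule p 2 1, f 1 = 1 ∧
      ∀ a ∈ H₁, ∀ b ∈ H₂, ∀ c ∈ H₃, a * b * c ≠ 1 → f (a * b * c) = 0) :
    Nat.card H₁ * Nat.card H₂ * Nat.card H₃ ≤ p * ((p + 1) * (p + 1)) * (p - 1) := by
  obtain ⟨E₁, hE₁le, he₁, hE₁B⟩ := exists_upper_part H₁
  obtain ⟨D₂, hD₂le, hd₂, hD₂B⟩ := exists_diag_part H₂
  obtain ⟨S₃, hS₃le, hs₃, hS₃B⟩ := exists_upper_part H₃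
  have h := torus_budget_middle htpp hU₂ hE₁le hD₂le hS₃le he₁ hd₂ hs₃ hdesign
  have h1 := card_le_succ_mul_card_upper H₁ E₁ hE₁B
  have h2 := card_le_mul_diag_upper hB₂ hU₂ hD₂B
  have h3 := card_le_succ_mul_card_upper H₃ S₃ hS₃B
  calc Nat.card H₁ * Nat.card H₂ * Nat.card H₃
      ≤ (p + 1) * Nat.card E₁ * (p * Nat.card D₂) * ((p + 1) * Nat.card S₃) :=
        Nat.mul_le_mul (Nat.mul_le_mul h1 h2) h3
    _ = p * ((p + 1) * (p + 1)) * (Nat.card E₁ * Nat.card D₂ * Nat.card S₃) := by ring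
    _ ≤ p * ((p + 1) * (p + 1)) * (p - 1) := Nat.mul_le_mul_left _ h

/-- **NO LEVEL-ONE WITNESS WITH A BOREL-TYPE `p`-MEMBER IN THE MIDDLE** (all primes `p ≥ 5`, all
`0 < ε ≤ 1`; `H₁, H₃` arbitrary): if `H₂` is conjugate to a subgroup `K` with `U⁺ ≤ K ≤ B⁺`. -/
theorem no_levelOne_witness_borel_middle (hp5 : 5 ≤ p) {ε : ℝ} (hε : 0 < ε) (hε1 : ε ≤ 1)
    {H₁ H₂ H₃ : Subgroup (GLm p 2)} (htpp : SubgroupTPP H₁ H₂ H₃)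
    (hframe : ∃ g : GLm p 2, (∀ k ∈ H₂.map (MulAut.conj g⁻¹).toMonoidHom, (k : Mat p 2) 1 0 = 0) ∧
      ∀ u : GLm p 2, (u : Mat p 2) 1 0 = 0 → (u : Mat p 2) 0 0 = 1 → (u : Mat p 2) 1 1 = 1 →
        u ∈ H₂.map (MulAut.conj g⁻¹).toMonoidHom)
    (hdesign : ∃ c : Mat p 2 → ℂ, (∀ M, 1 < M.rank → c M = 0) ∧
      (∑ M, c M * ZMod.stdAddChar (Matrix.trace (M * ((1 : GLm p 2) : Mat p 2)))) = 1 ∧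
      ∀ a ∈ H₁, ∀ b ∈ H₂, ∀ g ∈ H₃, a * b * g ≠ 1 →
        (∑ M, c M *
          ZMod.stdAddChar (Matrix.trace (M * ((a * b * g : GLm p 2) : Mat p 2)))) = 0) :
    ¬ budget p 2 1 (2 + ε) <
      ((Nat.card H₁ * Nat.card H₂ * Nat.card H₃ : ℕ) : ℝ) ^ ((2 + ε) / 3) := by
  obtain ⟨c, hc, hc1, hc0⟩ := hdesign
  obtain ⟨g, hB, hU⟩ := hframe
  have htpp' : SubgroupTPP (H₁.map (MulAut.conj g⁻¹).toMonoidHom)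
      (H₂.map (MulAut.conj g⁻¹).toMonoidHom) (H₃.map (MulAut.conj g⁻¹).toMonoidHom) :=
    subgroupTPP_map_of_injective _ (MulAut.conj g⁻¹).injective htpp
  have hdes' := idTest_map_conj g
    (⟨fourierFn c, fourierFn_mem_levelSubmodule hc, hc1, fun a ha b hb g hg hne =>
      hc0 a ha b hb g hg hne⟩ : ∃ f ∈ levelSubmodule p 2 1, f 1 = 1 ∧
      ∀ a ∈ H₁, ∀ b ∈ H₂, ∀ c ∈ H₃, a * b * c ≠ 1 → f (a * b * c) = 0)
  have h := volume_law_middle htpp' hB hU hdes'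
  have hc : ∀ H : Subgroup (GLm p 2),
      Nat.card (H.map (MulAut.conj g⁻¹).toMonoidHom) = Nat.card H := fun H =>
    (Nat.card_congr
      (Subgroup.equivMapOfInjective H _ (MulAut.conj g⁻¹).injective).toEquiv).symm
  rw [hc H₁, hc H₂, hc H₃] at h
  exact no_levelOne_witness_of_volume_le_nat (by linarith) hε1
    (h.trans (mul_succ_sq_mul_pred_le_floor hp5))

end MiddleTorus

end Summit.MatrixMultiplication.MatrixMultiplication.Theorems.SubgroupIdentityDesigns.Negative

end
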